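import Literature.Computability.Complexity.FKPointLocationProtocolPhases
import HarnessLib

/-!
# Fournier–Koiran point location, IX: the protocol produces a valid certificate

Topic `Literature/Computability/Complexity`, grouping namespace `FKPointLocation`. Correctness of the
location protocol of `FKPointLocationProtocol.lean` (Fournier–Koiran, ICALP 2000 = LIP RR-1999-21,
§2.1, Thm 2): run with truthful answers on an input `x̂ ≠ 0`, it ends with a state whose certificate
(`certOf`) is `Cert.Valid` for `x̂` (`FKPointLocationCertificates.lean`), and whose output bit is
the truth of the final question about that certificate: `finalData_valid`. With
`Cert.sign_lin_xStar_eq` this locates `x̂` in the arrangement of all small integer forms.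

Structure of the proof: the invariant `Inv` at the start of a level (partial validity
`Cert.ValidBelow`, the level facts `LevelOK` of the completed levels, consistency of the chart and
of the apex records); the level step (`level_step`: binary search — `run_bs` with the lift lemma
`sign_aff_liftAll`; searches — `run_scales`, `run_ap` with the level mathematics
`LevelCtx.apex_property`; equality tests and facet choice — `run_eq`, `run_fa`; `finishLevel`);
level `0` (`level_zero`); termination at level `D` (all coordinates fixed, `card_fixed_eq`); and
the idle tail after the bottom.

## References

* H. Fournier, P. Koiran, *Lower bounds are not easier over the reals: inside PH*, ICALP 2000,
  LNCS 1853 = LIP RR-1999-21, §2.1 (Steps 1 and k), §2.3, Thm 2. [FournierKoiran2000]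
-/

namespace Literature.Computability.Complexity

namespace FKPointLocation

open Finset

variable (Q : LevelParams) {finT : Cert Q.D → Prop} {xh : Fin Q.D → ℝ}

/-! ### The certificate of a state: dependence on the records -/

section Records

variable {Q}

/-- `certOf` depends only on the records. [folklore] -/
theorem certOf_withCur (dat : Data Q.D) (c : Scratch Q.D) : certOf Q (dat.withCur c) = certOf Q dat := rfl

/-- Records of earlier levels are unchanged when a new record is prepended. [folklore] -/
theorem recAt_cons_of_lt (dat : Data Q.D) (r : LevelRec Q.D) (d' : Data Q.D) (h : d'.levels = r :: dat.levels)
    {j : ℕ} (hj : j < dat.levels.length) : Data.recAt Q d' j = Data.recAt Q dat j := by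
  simp only [Data.recAt, Data.levelsOld, h, List.reverse_cons]
  rw [List.getElem?_append_left (by simpa using hj)]

/-- The new record sits at index `|levels|`. [folklore] -/
theorem recAt_cons_self (dat : Data Q.D) (r : LevelRec Q.D) (d' : Data Q.D) (h : d'.levels = r :: dat.levels) :
    Data.recAt Q d' dat.levels.length = r := by
  simp only [Data.recAt, Data.levelsOld, h, List.reverse_cons]
  rw [List.getElem?_append_right (by simp)]
  simp

/-- The record at a recorded index, through the reversed list. [folklore] -/
theorem recAt_eq_getElem (dat : Data Q.D) {k : ℕ} (hk : k < dat.levels.length) :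
    Data.recAt Q dat (dat.levels.length - 1 - k) = dat.levels[k] := by
  rw [Data.recAt, Data.levelsOld, List.getElem?_reverse (by omega)]
  have : dat.levels.length - 1 - (dat.levels.length - 1 - k) = k := by omega
  rw [this, List.getElem?_eq_getElem hk]
  rfl

/-- FULL AGREEMENT of two certificates below `n` (all fields). [folklore] -/
def PAgree (Γ Γ' : Cert Q.D) (n : ℕ) : Prop :=
  ∀ j < n, Γ.p j = Γ'.p j ∧ Γ.ρ j = Γ'.ρ j ∧ Γ.s j = Γ'.s j ∧ Γ.istar j = Γ'.istar j ∧ Γ.εstar j = Γ'.εstar j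

/-- Full agreement gives agreement of apexes and exits. [folklore] -/
theorem PAgree.agree {Γ Γ' : Cert Q.D} {n : ℕ} (h : PAgree Γ Γ' n) : Cert.Agree Γ Γ' n :=
  fun j hj => ⟨(h j hj).2.2.1, (h j hj).2.2.2.1, (h j hj).2.2.2.2⟩

/-- Full agreement is monotone. [folklore] -/
theorem PAgree.mono {Γ Γ' : Cert Q.D} {n n' : ℕ} (h : PAgree Γ Γ' n) (hn : n' ≤ n) : PAgree Γ Γ' n' :=
  fun j hj => h j (by omega)

/-- Prepending records keeps the certificate below the old length. [folklore] -/
theorem pAgree_of_cons (dat : Data Q.D) (r : LevelRec Q.D) (d' : Data Q.D) (h : d'.levels = r :: dat.levels) :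
    PAgree (certOf Q dat) (certOf Q d') dat.levels.length := by
  intro j hj
  simp only [certOf, recAt_cons_of_lt dat r d' h hj, and_self]

end Records

/-! ### Level facts and the invariant -/

section Invariant

variable {Q}

/-- The validity facts of a completed level `j ≥ 1` (fields `rho`, `s_fixed`, `s_near`, `x_near`,
`apex` of `Cert.Valid` at `j`). [cite: FournierKoiran2000, §2.1] -/
def LevelOK (Γ : Cert Q.D) (xh : Fin Q.D → ℝ) (j : ℕ) : Prop :=
  (0 < Γ.ρ j ∧ Q.r ≤ Γ.ρ j / 4 ∧ Γ.ρ j ≤ 1) ∧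
  (∀ i, Γ.chart j i ≠ 0 → Γ.s j i = Γ.chart j i) ∧
  (∀ i, Γ.chart j i = 0 → |Γ.s j i - Γ.p j i| ≤ Γ.ρ j / 4) ∧
  (∀ i, Γ.chart j i = 0 → |Γ.xProj xh j i - Γ.p j i| ≤ Q.r) ∧
  (∀ a, Γ.Live Q.B j a → Meets (Γ.chart j) (Γ.p j) (Γ.ρ j) a → ∑ i, (a i : ℚ) * Γ.s j i = 0)

/-- Level facts transfer along full agreement up to the level. [folklore] -/
theorem LevelOK.congr {Γ Γ' : Cert Q.D} {j : ℕ} (h : LevelOK Γ xh j) (hA : PAgree Γ Γ' (j + 1)) :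
    LevelOK Γ' xh j := by
  obtain ⟨hp, hρ, hs, hi, hε⟩ := hA j (Nat.lt_succ_self j)
  have hc : Γ.chart j = Γ'.chart j := Cert.chart_congr hA.agree j (Nat.le_succ j)
  have hx : Γ.xProj xh j = Γ'.xProj xh j := Cert.xProj_congr hA.agree j (Nat.le_succ j)
  have hlive : ∀ a, Γ'.Live Q.B j a ↔ Γ.Live Q.B j a := by
    intro a
    simp only [Cert.Live]
    constructor
    · rintro ⟨h1, h2⟩; exact ⟨h1, fun j' hj' => by rw [(hA j' (by omega)).2.2.1]; exact h2 j' hj'⟩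
    · rintro ⟨h1, h2⟩; exact ⟨h1, fun j' hj' => by rw [← (hA j' (by omega)).2.2.1]; exact h2 j' hj'⟩
  obtain ⟨h1, h2, h3, h4, h5⟩ := h
  rw [hp, hρ, hs, hc, hx] at *
  exact ⟨h1, h2, h3, h4, fun a ha hm => h5 a ((hlive a).1 ha) hm⟩

/-- **The invariant at the start of level `j`**: not done, fresh scratch, `j` records with positive
apex denominators, the stored chart is `χ_j`, the certificate is valid below `j`, the completed
levels `1 ≤ j' < j` satisfy their level facts, and the level-`0` record is the homogenisation record.
[cite: FournierKoiran2000, §2.1] -/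
structure Inv (xh : Fin Q.D → ℝ) (dat : Data Q.D) (j : ℕ) : Prop where
  done : dat.done = false
  cur : dat.cur = Scratch.init Q.D
  len : dat.levels.length = j
  apex_pos : ∀ r ∈ dat.levels, 0 < r.apex.2
  chart_eq : dat.chart = (certOf Q dat).chart j
  vb : (certOf Q dat).ValidBelow xh j
  lv : ∀ j', 1 ≤ j' → j' < j → LevelOK (certOf Q dat) xh j'
  rec0 : 0 < j → (Data.recAt Q dat 0).apex = (0, 1) ∧ (Data.recAt Q dat 0).m = 0

/-- **The invariant after the bottom** (level `J`): done, `J+1` records, valid below `J`, level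
facts for `1 ≤ j ≤ J`, and `x^{(J)} = s_J`. [cite: FournierKoiran2000, §2.1] -/
structure FinalInv (xh : Fin Q.D → ℝ) (dat : Data Q.D) (J : ℕ) : Prop where
  done : dat.done = true
  len : dat.levels.length = J + 1
  vb : (certOf Q dat).ValidBelow xh J
  lv : ∀ j', 1 ≤ j' → j' ≤ J → LevelOK (certOf Q dat) xh j'
  bottom : (certOf Q dat).xProj xh J = (certOf Q dat).sR J
  rec0 : (Data.recAt Q dat 0).apex = (0, 1) ∧ (Data.recAt Q dat 0).m = 0
  apex_pos : ∀ r ∈ dat.levels, 0 < r.apex.2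

/-- A state after the bottom yields a VALID certificate. [cite: FournierKoiran2000, §2.1, Thm 2] -/
theorem FinalInv.valid {dat : Data Q.D} {J : ℕ} (h : FinalInv xh dat J) : (certOf Q dat).Valid xh Q.B Q.r := by
  have hJ : (certOf Q dat).J = J := by simp [certOf, h.len]
  refine ⟨?_, ?_, ?_, ?_, ?_, ?_, ?_, ?_, ?_, ?_, ?_⟩
  · funext i
    simp [certOf, h.rec0.1]
  · unfold LevelParams.r; positivity
  · intro j hj1 hj; rw [hJ] at hj; exact (h.lv j hj1 hj).1
  · intro j hj1 hj; rw [hJ] at hj; exact (h.lv j hj1 hj).2.1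
  · intro j hj1 hj; rw [hJ] at hj; exact (h.lv j hj1 hj).2.2.1
  · intro j hj1 hj; rw [hJ] at hj; exact (h.lv j hj1 hj).2.2.2.1
  · intro j hj1 hj; rw [hJ] at hj; exact (h.lv j hj1 hj).2.2.2.2
  · intro j hj; rw [hJ] at hj; exact h.vb.exit_free j hj
  · intro j hj; rw [hJ] at hj; exact h.vb.exit_sign j hj
  · intro j hj; rw [hJ] at hj; exact h.vb.exit_min j hj
  · rw [hJ]; exact h.bottom

end Invariant

/-! ### The apex records match the certificate -/

section Hist

variable {Q}

/-- Under the invariant, the stored apex records match the certificate's levels `j-1, …, 0`.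
[folklore] -/
theorem hist_matches {dat : Data Q.D} {j : ℕ} (hI : Inv xh dat j) :
    ∀ k (hk : k < dat.hist.length), Cert.Matches dat.hist[k] (certOf Q dat) (j - 1 - k) := by
  intro k hk
  have hk' : k < dat.levels.length := by simpa [Data.hist] using hk
  have hrec : Data.recAt Q dat (j - 1 - k) = dat.levels[k] := by
    rw [← hI.len]; exact recAt_eq_getElem dat hk'
  have hget : dat.hist[k] = ⟨(dat.levels[k]).apex.1, (dat.levels[k]).apex.2, (dat.levels[k]).istar, (dat.levels[k]).εstar⟩ := by
    simp [Data.hist, List.getElem_map]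
  rw [hget]
  refine ⟨hI.apex_pos _ (List.getElem_mem hk'), ?_, ?_, ?_⟩
  · funext i
    simp [ApexRec.pt, Cert.sR, certOf, hrec]
  · simp [certOf, hrec]
  · simp [certOf, hrec]

/-- **Under the invariant, a sign task's truthful answer is the sign bit of its LOCAL form at the
projected point `x^{(j)}`.** [cite: FournierKoiran2000, §2.1 Lemma 2] -/
theorem truth_sign_eq {dat : Data Q.D} {j : ℕ} (hI : Inv xh dat j) (c : Scratch Q.D) (τ : Task Q.D)
    (hτ : τ.isSign = true) :
    truth finT (certOf Q) xh (dat.withCur c) τ =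
      decide (0 ≤ aff (localForm (dat.withCur c) τ) ((certOf Q dat).xProj xh j)) := by
  rw [truth, hτ]
  simp only [if_true, queryForm, Data.hist_withCur]
  apply decide_nonneg_eq_of_sign_eq
  have hlen : dat.hist.length = j := by simp [Data.hist, hI.len]
  exact Cert.sign_aff_liftAll hI.vb dat.hist j hlen le_rfl (hist_matches hI) _

end Hist

/-! ### The facet fold -/

section Fold

variable {Q}

/-- **Specification of the facet fold**: either no coordinate of the list is valid and the result is
`none`, or the result is a valid coordinate of the list minimising `μ` among the valid ones.
[cite: FournierKoiran2000, §2.1 (the face hit first by the ray)] -/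
theorem faFold_spec (valid : Fin Q.D → Bool) (b : Fin Q.D → Fin Q.D → Bool) (μ : Fin Q.D → ℝ)
    (hb : ∀ c i, valid c = true → valid i = true → c ≠ i → (b c i = true ↔ μ c ≤ μ i)) :
    ∀ l : List (Fin Q.D), l.Nodup →
      (l.foldl (faFold valid b) none = none ∧ ∀ i ∈ l, valid i = false) ∨
      (∃ c, l.foldl (faFold valid b) none = some c ∧ valid c = true ∧ c ∈ l ∧
        ∀ i ∈ l, valid i = true → μ c ≤ μ i) := by
  intro l hl
  induction l using List.reverseRecOn with
  | nil => left; exact ⟨rfl, fun i hi => by simp at hi⟩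
  | append_singleton l i ih =>
    have hl' : l.Nodup := (List.nodup_append.1 hl).1
    have hi_notin : i ∉ l := by
      intro h
      have := (List.nodup_append.1 hl).2.2 i h i (List.mem_singleton_self i)
      exact this rfl
    rw [List.foldl_append, List.foldl_cons, List.foldl_nil]
    rcases ih hl' with ⟨hnone, hall⟩ | ⟨c, hc, hvc, hcl, hmin⟩
    · rw [hnone, faFold]
      cases hv : valid i with
      | false =>
        left
        refine ⟨by simp, fun i' hi' => ?_⟩
        rcases List.mem_append.1 hi' with h | h
        · exact hall i' h
        · simp only [List.mem_singleton] at h; subst h; exact hv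
      | true =>
        right
        refine ⟨i, by simp, hv, by simp, fun i' hi' hv' => ?_⟩
        rcases List.mem_append.1 hi' with h | h
        · rw [hall i' h] at hv'; exact absurd hv' (by simp)
        · simp only [List.mem_singleton] at h; subst h; exact le_rfl
    · rw [hc, faFold]
      cases hv : valid i with
      | false =>
        right
        refine ⟨c, by simp, hvc, List.mem_append_left _ hcl, fun i' hi' hv' => ?_⟩
        rcases List.mem_append.1 hi' with h | h
        · exact hmin i' h hv'
        · simp only [List.mem_singleton] at h; subst h; rw [hv] at hv'; exact absurd hv' (by simp)
      | true =>
        have hci : c ≠ i := fun h => hi_notin (h ▸ hcl)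
        have hbi := hb c i hvc hv hci
        right
        cases hbv : b c i with
        | true =>
          refine ⟨c, by simp, hvc, List.mem_append_left _ hcl, fun i' hi' hv' => ?_⟩
          rcases List.mem_append.1 hi' with h | h
          · exact hmin i' h hv'
          · simp only [List.mem_singleton] at h; subst h; exact hbi.1 hbv
        | false =>
          have hlt : μ i < μ c := by
            by_contra hge; push Not at hge
            have := hbi.2 hge; rw [hbv] at this; exact absurd this (by simp)
          refine ⟨i, by simp, hv, by simp, fun i' hi' hv' => ?_⟩
          rcases List.mem_append.1 hi' with h | h
          · exact (hlt.le).trans (hmin i' h hv')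
          · simp only [List.mem_singleton] at h; subst h; exact le_rfl

end Fold

/-! ### Semantics of the equality bits and of the facet comparison -/

section Semantics

variable {Q}

/-- The three-valued sign read off the two truthful equality bits. [folklore] -/
theorem signOf_decide (u : ℝ) :
    signOf (decide (0 ≤ u)) (decide (0 ≤ -u)) = if 0 < u then 1 else if u < 0 then -1 else 0 := by
  rcases lt_trichotomy u 0 with h | h | h
  · rw [signOf, decide_eq_false (not_le.2 h)]
    simp [h, not_lt.2 h.le]
  · subst h; simp [signOf]
  · rw [signOf, decide_eq_true h.le, decide_eq_false (by linarith)]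
    simp [h]

/-- The sign is non-zero iff the coordinate moves. [folklore] -/
theorem signOf_decide_ne_zero_iff (u : ℝ) :
    signOf (decide (0 ≤ u)) (decide (0 ≤ -u)) ≠ 0 ↔ u ≠ 0 := by
  rw [signOf_decide]
  rcases lt_trichotomy u 0 with h | h | h
  · simp [h, not_lt.2 h.le, h.ne]
  · subst h; simp
  · simp [h, h.ne']

/-- For a moving coordinate, `(signOf …) · u = |u|`. [folklore] -/
theorem signOf_decide_mul (u : ℝ) (hu : u ≠ 0) :
    ((signOf (decide (0 ≤ u)) (decide (0 ≤ -u)) : ℤ) : ℝ) * u = |u| := by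
  rw [signOf_decide]
  rcases lt_or_gt_of_ne hu with h | h
  · rw [if_neg (not_lt.2 h.le), if_pos h, abs_of_neg h]; push_cast; ring
  · rw [if_pos h, abs_of_pos h]; push_cast; ring

/-- The hitting parameter of a coordinate: `μ_k = (1 - ε_k s_k)/|y_k - s_k|`. [cite: FournierKoiran2000, §2.1] -/
noncomputable def hitParam (y s : Fin Q.D → ℝ) (k : Fin Q.D) : ℝ :=
  (1 - (signOf (decide (0 ≤ y k - s k)) (decide (0 ≤ -(y k - s k))) : ℝ) * s k) / |y k - s k|

/-- **The facet-comparison form decides `μ_c ≤ μ_i`** for two distinct moving coordinates.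
[cite: FournierKoiran2000, §2.1 (the hyperplanes `Aff(y, f)` testing in which pyramid the point lies)] -/
theorem faForm_nonneg_iff (apex : (Fin Q.D → ℤ) × ℕ) (hd : 0 < apex.2) (y : Fin Q.D → ℝ) {c i : Fin Q.D}
    (hci : c ≠ i) (hc : y c - (apex.1 c : ℝ) / apex.2 ≠ 0) (hi : y i - (apex.1 i : ℝ) / apex.2 ≠ 0) :
    let s : Fin Q.D → ℝ := fun k => (apex.1 k : ℝ) / apex.2
    0 ≤ aff (faForm apex (signOf (decide (0 ≤ y c - s c)) (decide (0 ≤ -(y c - s c))))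
        (signOf (decide (0 ≤ y i - s i)) (decide (0 ≤ -(y i - s i)))) c i) y ↔
      hitParam y s c ≤ hitParam y s i := by
  intro s
  rw [aff_faForm apex hd _ _ hci y]
  have hdc : 0 < |y c - s c| := abs_pos.2 hc
  have hdi : 0 < |y i - s i| := abs_pos.2 hi
  have hmc := signOf_decide_mul (y c - s c) hc
  have hmi := signOf_decide_mul (y i - s i) hi
  set εc : ℝ := (signOf (decide (0 ≤ y c - s c)) (decide (0 ≤ -(y c - s c))) : ℝ)
  set εi : ℝ := (signOf (decide (0 ≤ y i - s i)) (decide (0 ≤ -(y i - s i))) : ℝ)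
  have hd2 : (0 : ℝ) < (apex.2 : ℝ) ^ 2 := by positivity
  rw [hitParam, hitParam, div_le_div_iff₀ hdc hdi]
  change 0 ≤ (apex.2 : ℝ) ^ 2 * ((1 - εi * s i) * (εc * (y c - s c)) - (1 - εc * s c) * (εi * (y i - s i))) ↔
    (1 - εc * s c) * |y i - s i| ≤ (1 - εi * s i) * |y c - s c|
  rw [hmc, hmi, mul_nonneg_iff_of_pos_left hd2, sub_nonneg]

end Semantics

/-! ### Equality tests, facet choice, and closing a level -/

section Close

variable {Q}

/-- The data used to close level `j`: from a state `dat` satisfying the invariant and a scratch `base`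
(apex `(σ, d)`), the equality bits and the candidate computed with the truthful answers. [folklore] -/
noncomputable def closeScratch (dat : Data Q.D) (j : ℕ) (xh : Fin Q.D → ℝ) (base : Scratch Q.D) : Scratch Q.D :=
  let y := (certOf Q dat).xProj xh j
  let s : Fin Q.D → ℝ := fun k => (base.apex.1 k : ℝ) / base.apex.2
  let ge : Fin Q.D → Bool := fun i => decide (0 ≤ y i - s i)
  let le : Fin Q.D → Bool := fun i => decide (0 ≤ -(y i - s i))
  let base' : Scratch Q.D := { base with ge := ge, le := le }
  let bb : Fin Q.D → Fin Q.D → Bool := fun c i =>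
    decide (0 ≤ aff (faForm base.apex (signOf (ge c) (le c)) (signOf (ge i) (le i)) c i) y)
  { base' with cand := (List.finRange Q.D).foldl (faFold ((dat.withCur base').validB) bb) none }

/-- **Closing a level**: the equality tests, the facet comparisons and the closing task turn
`dat.withCur base` into `finishLevel` of the closing scratch. [cite: FournierKoiran2000, §2.1 (test `x = s_n^k`; choice of the face)] -/
theorem run_close_level {dat : Data Q.D} {j : ℕ} (hI : Inv xh dat j) (base : Scratch Q.D)
    (hd : 0 < base.apex.2) (hcand : base.cand = none) :
    runFrom Q finT xh (dat.withCur base)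
        (((List.finRange Q.D).flatMap fun i => [Task.eqGe i, Task.eqLe i]) ++
          (List.finRange Q.D).map Task.fa ++ [Task.close]) =
      finishLevel Q (dat.withCur (closeScratch dat j xh base)) := by
  set y := (certOf Q dat).xProj xh j with hy
  set s : Fin Q.D → ℝ := fun k => (base.apex.1 k : ℝ) / base.apex.2 with hs
  set ge : Fin Q.D → Bool := fun i => decide (0 ≤ y i - s i) with hge
  set le : Fin Q.D → Bool := fun i => decide (0 ≤ -(y i - s i)) with hle
  have hdone := hI.done
  -- equality tests
  have hEQ := run_eq (finT := finT) (xh := xh) dat hdone base ge le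
    (fun g l i => by
      rw [truth_sign_eq hI _ _ rfl, hge]
      simp only [localForm]
      change decide (0 ≤ aff (geForm base.apex i) y) = decide (0 ≤ y i - s i)
      rw [aff_geForm base.apex hd]
      have hdR : (0 : ℝ) < base.apex.2 := by exact_mod_cast hd
      by_cases h : 0 ≤ y i - s i
      · rw [decide_eq_true h, decide_eq_true (mul_nonneg hdR.le h)]
      · rw [decide_eq_false h, decide_eq_false]
        intro h'; exact h ((mul_nonneg_iff_of_pos_left hdR).1 h'))
    (fun g l i => by
      rw [truth_sign_eq hI _ _ rfl, hle]
      simp only [localForm]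
      change decide (0 ≤ aff (leForm base.apex i) y) = decide (0 ≤ -(y i - s i))
      rw [aff_leForm base.apex hd]
      have hdR : (0 : ℝ) < base.apex.2 := by exact_mod_cast hd
      by_cases h : 0 ≤ -(y i - s i)
      · rw [decide_eq_true h, decide_eq_true (mul_nonneg hdR.le (by linarith))]
      · rw [decide_eq_false h, decide_eq_false]
        intro h'
        have := (mul_nonneg_iff_of_pos_left hdR).1 h'
        exact h (by linarith))
    (List.finRange Q.D)
  have hfun : ∀ (f g' : Fin Q.D → Bool), (fun i => if i ∈ List.finRange Q.D then f i else g' i) = f := by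
    intro f g'; funext i; simp [List.mem_finRange]
  rw [hfun, hfun] at hEQ
  rw [List.append_assoc, runFrom_append, hEQ, runFrom_append]
  -- facet comparisons
  set base' : Scratch Q.D := { base with ge := ge, le := le } with hbase'
  have hFA := run_fa (finT := finT) (xh := xh) dat hdone base'
    (fun c i => decide (0 ≤ aff (faForm base.apex (signOf (ge c) (le c)) (signOf (ge i) (le i)) c i) y))
    (fun c i _ => by
      rw [truth_sign_eq hI _ _ rfl]
      rfl)
    (List.finRange Q.D)
  rw [hFA, run_close _ (by rw [Data.withCur_done]; exact hdone)]
  have hc' : base'.cand = none := hcand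
  rw [hc']
  rfl

end Close

/-! ### The fields of the certificate at a new record -/

section NewRecord

variable {Q}

/-- The certificate's level at a freshly prepended record. [folklore] -/
theorem certOf_at_new (dat : Data Q.D) (r : LevelRec Q.D) (d' : Data Q.D) (h : d'.levels = r :: dat.levels) :
    (certOf Q d').p dat.levels.length = (fun i => (r.m i : ℚ) / 2 ^ (Q.L + 1)) ∧
    (certOf Q d').ρ dat.levels.length = Q.ρ (r.sc + 1) ∧
    (certOf Q d').s dat.levels.length = (fun i => (r.apex.1 i : ℚ) / r.apex.2) ∧
    (certOf Q d').istar dat.levels.length = r.istar ∧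
    (certOf Q d').εstar dat.levels.length = r.εstar := by
  simp only [certOf, recAt_cons_self dat r d' h, and_self]

end NewRecord

/-! ### Closing: the two outcomes -/

section Finish

variable {Q}

/-- `finishLevel` at the bottom. [folklore] -/
theorem finishLevel_none (dat : Data Q.D) (h : dat.cur.cand = none) :
    finishLevel Q dat =
      { dat with done := true, levels := closeRec Q dat.cur ⟨0, Q.D_pos⟩ 1 :: dat.levels, cur := Scratch.init Q.D } := by
  simp only [finishLevel, h]

/-- `finishLevel` with an exit facet. [folklore] -/
theorem finishLevel_some (dat : Data Q.D) (c : Fin Q.D) (h : dat.cur.cand = some c) :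
    finishLevel Q dat =
      { dat with chart := Function.update dat.chart c (if dat.cur.ge c then 1 else -1),
                 levels := closeRec Q dat.cur c (if dat.cur.ge c then 1 else -1) :: dat.levels,
                 cur := Scratch.init Q.D } := by
  simp only [finishLevel, h]

end Finish

/-! ### The level step -/

section Step

variable {Q}

/-- The centre numerators of level `j`: fixed coordinates `χ_i 2^{L+1}`, free ones from binary search
of `x^{(j)}_i`. [cite: FournierKoiran2000, §2.1 Step 1] -/
noncomputable def mStar (dat : Data Q.D) (j : ℕ) (xh : Fin Q.D → ℝ) : Fin Q.D → ℤ :=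
  fun i => if dat.chart i ≠ 0 then dat.chart i * 2 ^ (Q.L + 1) else bsCentreNum ((certOf Q dat).xProj xh j i) Q.L

/-- The level context of level `j`. [cite: FournierKoiran2000, §2.1] -/
noncomputable def ctxStar (dat : Data Q.D) (j : ℕ) (xh : Fin Q.D → ℝ) : LevelCtx Q :=
  ⟨dat.chart, dat.levels.map fun r => r.apex.1, mStar dat j xh⟩

/-- The level context of level `j ≥ 1` is well formed under the invariant. [folklore] -/
theorem ctxStar_wf {dat : Data Q.D} {j : ℕ} (hI : Inv xh dat j) (hj1 : 1 ≤ j) : (ctxStar dat j xh).WF := by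
  have htri := Cert.chart_trichotomy_of_validBelow hI.vb j le_rfl
  have hcube := (Cert.xProj_mem_unitCube_of_validBelow hI.vb j le_rfl).2 hj1
  refine ⟨fun i => ?_, fun i hi => ?_, fun i => ?_⟩
  · have := htri i; rw [← hI.chart_eq] at this; exact this
  · have hi' : dat.chart i ≠ 0 := hi
    simp [ctxStar, mStar, hi']
  · simp only [ctxStar, mStar]
    split_ifs with h
    · have := htri i; rw [← hI.chart_eq] at this
      rcases this with h0 | h1 | h1
      · exact absurd h0 h
      · simp [h1, Int.natAbs_pow]
      · simp [h1, Int.natAbs_neg, Int.natAbs_pow]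
    · exact (natAbs_bsCentreNum_lt (hcube i) Q.L).le

/-- **The level facts of a level closed with an apex satisfying the apex predicate** (for any
certificate `Γ'` whose level `j` carries the level's data). [cite: FournierKoiran2000, §2.1 Step k] -/
theorem levelOK_of_apexPred {dat : Data Q.D} {j : ℕ} (hI : Inv xh dat j) (hj1 : 1 ≤ j)
    {N : Fin Q.D → ℤ} {d : ℕ}
    (hA : (ctxStar dat j xh).ApexPred (ctxStar dat j xh).chooseForm ((ctxStar dat j xh).scStar (ctxStar dat j xh).chooseForm) N d)
    {Γ' : Cert Q.D} (hchart : Γ'.chart j = dat.chart) (hx : Γ'.xProj xh j = (certOf Q dat).xProj xh j)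
    (hp : Γ'.p j = fun i => (mStar dat j xh i : ℚ) / 2 ^ (Q.L + 1))
    (hρ : Γ'.ρ j = Q.ρ ((ctxStar dat j xh).scStar (ctxStar dat j xh).chooseForm + 1))
    (hs : Γ'.s j = fun i => (N i : ℚ) / d)
    (hprev : ∀ j' < j, ∃ r ∈ dat.levels, 0 < r.apex.2 ∧ Γ'.s j' = fun i => (r.apex.1 i : ℚ) / r.apex.2)
    (hprev' : ∀ r ∈ dat.levels, ∃ j' < j, Γ'.s j' = fun i => (r.apex.1 i : ℚ) / r.apex.2) :
    LevelOK Γ' xh j := by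
  set Λ := ctxStar dat j xh with hΛ
  have hW : Λ.WF := ctxStar_wf hI hj1
  have hsd : Λ.SoundChoose Λ.chooseForm := Λ.soundChoose_chooseForm
  obtain ⟨hfix, hnear, hkill⟩ := Λ.apex_property hsd hW hA
  have hsc : Λ.scStar Λ.chooseForm ≤ Q.D := (Λ.scStar_spec hsd hW).1
  have hcube := (Cert.xProj_mem_unitCube_of_validBelow hI.vb j le_rfl).2 hj1
  refine ⟨⟨?_, ?_, ?_⟩, fun i hi => ?_, fun i hi => ?_, fun i hi => ?_, fun a hlive hmeets => ?_⟩
  · rw [hρ]; exact Q.ρ_pos _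
  · rw [hρ]; exact Q.r_le_ρ_div_four (by omega)
  · rw [hρ]; exact Q.ρ_le_one (by omega)
  · rw [hs, hchart]; rw [hchart] at hi
    exact hfix i hi
  · rw [hs, hp, hρ]; rw [hchart] at hi
    exact hnear i hi
  · -- binary search located the free coordinate
    rw [hx, hp]; rw [hchart] at hi
    have hm : mStar dat j xh i = bsCentreNum ((certOf Q dat).xProj xh j i) Q.L := by simp [mStar, hi]
    simp only [hm]
    have := abs_sub_bsCentre_le (hcube i) Q.L
    unfold LevelParams.r
    push_cast
    exact this
  · -- the apex kills the live forms meeting the cube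
    rw [hs]
    rw [hchart, hp, hρ] at hmeets
    refine hkill a ⟨hlive.1, fun σ hσ => ?_⟩ hmeets
    -- `σ` is the numerator vector of an earlier apex, at which `a` vanishes by liveness
    simp only [hΛ, ctxStar, List.mem_map] at hσ
    obtain ⟨r, hr, rfl⟩ := hσ
    obtain ⟨j', hj', hsj'⟩ := hprev' r hr
    have h0 := hlive.2 j' hj'
    rw [hsj'] at h0
    obtain ⟨r', hr', hdpos, hsj''⟩ := hprev j' hj'
    -- the denominator of `r` is positive: `r` is among the records
    have hdr : 0 < r.apex.2 := hI.apex_pos r hr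
    have hdq : (r.apex.2 : ℚ) ≠ 0 := by exact_mod_cast hdr.ne'
    have : (∑ i, (a i : ℚ) * ((r.apex.1 i : ℚ) / r.apex.2)) * r.apex.2 = 0 := by rw [h0, zero_mul]
    rw [Finset.sum_mul] at this
    have h1 : ∑ i, (a i : ℚ) * (r.apex.1 i : ℚ) = 0 := by
      rw [← this]; exact Finset.sum_congr rfl fun i _ => by field_simp
    exact_mod_cast h1

/-- The earlier apexes are the records' apexes (two directions), for any certificate agreeing below `j`.
[folklore] -/
theorem prev_records {dat : Data Q.D} {j : ℕ} (hI : Inv xh dat j) {Γ' : Cert Q.D} (hPA : PAgree (certOf Q dat) Γ' j) :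
    (∀ j'' < j, ∃ r ∈ dat.levels, 0 < r.apex.2 ∧ Γ'.s j'' = fun i => (r.apex.1 i : ℚ) / r.apex.2) ∧
    (∀ r ∈ dat.levels, ∃ j'' < j, Γ'.s j'' = fun i => (r.apex.1 i : ℚ) / r.apex.2) := by
  constructor
  · intro j'' hj''
    have hk : j - 1 - j'' < dat.levels.length := by rw [hI.len]; omega
    refine ⟨dat.levels[j - 1 - j''], List.getElem_mem hk, hI.apex_pos _ (List.getElem_mem hk), ?_⟩
    rw [← (hPA j'' hj'').2.2.1]
    have := recAt_eq_getElem dat hk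
    rw [hI.len, show j - 1 - (j - 1 - j'') = j'' by omega] at this
    simp [certOf, this]
  · intro r hr
    obtain ⟨k, hk, rfl⟩ := List.getElem_of_mem hr
    refine ⟨j - 1 - k, by rw [hI.len] at hk; omega, ?_⟩
    rw [← (hPA _ (by rw [hI.len] at hk; omega)).2.2.1]
    have := recAt_eq_getElem dat hk
    rw [hI.len] at this
    simp [certOf, this]

/-- Fixed coordinates of `x^{(j)}` agree with an apex in the chart. [folklore] -/
theorem xProj_eq_apex_of_fixed {dat : Data Q.D} {j : ℕ} (hI : Inv xh dat j) (hj1 : 1 ≤ j)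
    {N : Fin Q.D → ℤ} {d : ℕ}
    (hA : (ctxStar dat j xh).ApexPred (ctxStar dat j xh).chooseForm ((ctxStar dat j xh).scStar (ctxStar dat j xh).chooseForm) N d)
    (i : Fin Q.D) (hi : dat.chart i ≠ 0) : (certOf Q dat).xProj xh j i = (N i : ℝ) / d := by
  set Λ := ctxStar dat j xh
  obtain ⟨hfix, -, -⟩ := Λ.apex_property Λ.soundChoose_chooseForm (ctxStar_wf hI hj1) hA
  have hcube := (Cert.xProj_mem_unitCube_of_validBelow hI.vb j le_rfl)
  have h1 : (certOf Q dat).xProj xh j i = dat.chart i := by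
    rw [hI.chart_eq]; exact hcube.1 i (by rw [← hI.chart_eq]; exact hi)
  have h2 := hfix i hi
  have h3 : ((N i : ℝ) / d) = ((N i : ℚ) / d : ℚ) := by push_cast; rfl
  rw [h1, h3, h2]; push_cast; rfl

/-- **The bottom**: closing level `j` with no moving coordinate yields the final invariant.
[cite: FournierKoiran2000, §2.1 ("If `x = s_n^k` we accept")] -/
theorem finalInv_of_bottom {dat : Data Q.D} {j : ℕ} (hI : Inv xh dat j) (hj1 : 1 ≤ j)
    {N : Fin Q.D → ℤ} {d : ℕ}
    (hA : (ctxStar dat j xh).ApexPred (ctxStar dat j xh).chooseForm ((ctxStar dat j xh).scStar (ctxStar dat j xh).chooseForm) N d)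
    (dat' : Data Q.D) (hdone' : dat'.done = true) (i0 : Fin Q.D) (e0 : ℤ)
    (hlev : dat'.levels = ⟨mStar dat j xh, (ctxStar dat j xh).scStar (ctxStar dat j xh).chooseForm, (N, d), i0, e0⟩ :: dat.levels)
    (heq : ∀ i, dat.chart i = 0 → (certOf Q dat).xProj xh j i = (N i : ℝ) / d) :
    FinalInv xh dat' j := by
  have hPA : PAgree (certOf Q dat) (certOf Q dat') j := by rw [← hI.len]; exact pAgree_of_cons dat _ dat' hlev
  have hnew := certOf_at_new dat _ dat' hlev
  rw [hI.len] at hnew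
  obtain ⟨hp', hρ', hs', hi', hε'⟩ := hnew
  have hchart' : (certOf Q dat').chart j = dat.chart := by
    rw [← Cert.chart_congr hPA.agree j le_rfl, ← hI.chart_eq]
  have hx' : (certOf Q dat').xProj xh j = (certOf Q dat).xProj xh j := by rw [← Cert.xProj_congr hPA.agree j le_rfl]
  refine ⟨hdone', by rw [hlev, List.length_cons, hI.len], ?_, ?_, ?_, ?_, ?_⟩
  · exact hI.vb.congr hPA.agree (by omega)
  · intro j' hj1' hj'
    rcases Nat.lt_or_ge j' j with hlt | hge
    · exact (hI.lv j' hj1' hlt).congr (hPA.mono (by omega))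
    · have : j' = j := by omega
      subst this
      exact levelOK_of_apexPred hI hj1 hA hchart' hx' hp' hρ' hs' (prev_records hI hPA).1 (prev_records hI hPA).2
  · rw [hx']
    funext i
    have : (certOf Q dat').sR j i = (N i : ℝ) / d := by
      simp only [Cert.sR, hs']; push_cast; rfl
    rw [this]
    by_cases hi : dat.chart i = 0
    · exact heq i hi
    · exact xProj_eq_apex_of_fixed hI hj1 hA i hi
  · rw [recAt_cons_of_lt dat _ dat' hlev (by rw [hI.len]; exact hj1)]
    exact hI.rec0 hj1
  · intro r hr
    rw [hlev] at hr
    rcases List.mem_cons.1 hr with rfl | hr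
    · exact hA.1
    · exact hI.apex_pos r hr

/-- **Continuing**: closing level `j` with an exit facet yields the invariant at level `j+1`.
[cite: FournierKoiran2000, §2.1 ("Otherwise we repeat the same procedure in dimension `n-1`")] -/
theorem inv_of_continue {dat : Data Q.D} {j : ℕ} (hI : Inv xh dat j) (hj1 : 1 ≤ j)
    {N : Fin Q.D → ℤ} {d : ℕ}
    (hA : (ctxStar dat j xh).ApexPred (ctxStar dat j xh).chooseForm ((ctxStar dat j xh).scStar (ctxStar dat j xh).chooseForm) N d)
    (hd : 0 < d) (dat' : Data Q.D) (hdone' : dat'.done = false) (hcur' : dat'.cur = Scratch.init Q.D)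
    (c : Fin Q.D) (ε : ℤ)
    (hlev : dat'.levels = ⟨mStar dat j xh, (ctxStar dat j xh).scStar (ctxStar dat j xh).chooseForm, (N, d), c, ε⟩ :: dat.levels)
    (hchartd : dat'.chart = Function.update dat.chart c ε) (hfree : dat.chart c = 0)
    (hsign : (0 < (certOf Q dat).xProj xh j c - (N c : ℝ) / d ∧ ε = 1) ∨ ((certOf Q dat).xProj xh j c - (N c : ℝ) / d < 0 ∧ ε = -1))
    (hmin : ∀ i, dat.chart i = 0 → (certOf Q dat).xProj xh j i - (N i : ℝ) / d ≠ 0 →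
      hitParam ((certOf Q dat).xProj xh j) (fun k => (N k : ℝ) / d) c ≤
        hitParam ((certOf Q dat).xProj xh j) (fun k => (N k : ℝ) / d) i) :
    Inv xh dat' (j + 1) := by
  set y := (certOf Q dat).xProj xh j with hy
  set s : Fin Q.D → ℝ := fun k => (N k : ℝ) / d with hs
  set Λ := ctxStar dat j xh with hΛ
  obtain ⟨hfix, -, -⟩ := Λ.apex_property Λ.soundChoose_chooseForm (ctxStar_wf hI hj1) hA
  have hPA : PAgree (certOf Q dat) (certOf Q dat') j := by rw [← hI.len]; exact pAgree_of_cons dat _ dat' hlev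
  have hnew := certOf_at_new dat _ dat' hlev
  rw [hI.len] at hnew
  obtain ⟨hp', hρ', hs', hi', hε'⟩ := hnew
  have hchart' : (certOf Q dat').chart j = dat.chart := by
    rw [← Cert.chart_congr hPA.agree j le_rfl, ← hI.chart_eq]
  have hx' : (certOf Q dat').xProj xh j = y := by rw [← Cert.xProj_congr hPA.agree j le_rfl]
  have hsR' : (certOf Q dat').sR j = s := by
    funext i; simp only [Cert.sR, hs']; push_cast; rfl
  have hsc : 0 < y c - s c ∨ y c - s c < 0 := by
    rcases hsign with ⟨h, -⟩ | ⟨h, -⟩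
    · exact Or.inl h
    · exact Or.inr h
  have hexitParam : (certOf Q dat').exitParam xh j = hitParam y s c := by
    rw [Cert.exitParam, hx', hsR', hi', hε', hitParam, signOf_decide]
    rcases hsign with ⟨h, he⟩ | ⟨h, he⟩
    · rw [he, if_pos h]
    · rw [he, if_neg (not_lt.2 h.le), if_pos h]
  refine ⟨hdone', hcur', by rw [hlev, List.length_cons, hI.len], ?_, ?_, ?_, ?_, ?_⟩
  · intro r hr
    rw [hlev, List.mem_cons] at hr
    rcases hr with rfl | hr
    · exact hd
    · exact hI.apex_pos r hr
  · rw [hchartd]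
    funext i
    rw [Cert.chart_succ_apply, hi', hε', hchart', Function.update_apply]
  · have hvb' : (certOf Q dat').ValidBelow xh j := hI.vb.congr hPA.agree (by omega)
    refine ⟨?_, ?_, ?_, ?_, ?_⟩
    · rw [← (hPA 0 (by omega)).2.2.1]; exact hI.vb.s_zero
    · intro j' hj1' hj' i hi
      rcases Nat.lt_or_ge j' j with hlt | hge
      · exact hvb'.s_fixed j' hj1' hlt i hi
      · have : j' = j := by omega
        subst this
        rw [hchart'] at hi ⊢
        rw [hs']
        exact hfix i hi
    · intro j' hj'
      rcases Nat.lt_or_ge j' j with hlt | hge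
      · exact hvb'.exit_free j' hlt
      · have : j' = j := by omega
        subst this
        rw [hchart', hi']; exact hfree
    · intro j' hj'
      rcases Nat.lt_or_ge j' j with hlt | hge
      · exact hvb'.exit_sign j' hlt
      · have : j' = j := by omega
        subst this
        rw [hx', hsR', hi', hε']; exact hsign
    · intro j' hj' i hi
      rcases Nat.lt_or_ge j' j with hlt | hge
      · exact hvb'.exit_min j' hlt i hi
      · have : j' = j := by omega
        subst this
        rw [hchart'] at hi
        rw [hexitParam, hx', hsR']
        constructor
        · intro hpos
          have := hmin i hi hpos.ne'
          have hμ : hitParam y s i = (1 - s i) / (y i - s i) := by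
            rw [hitParam, signOf_decide, if_pos hpos, abs_of_pos hpos]; push_cast; ring
          rwa [hμ] at this
        · intro hneg
          have := hmin i hi hneg.ne
          have hμ : hitParam y s i = (1 + s i) / (s i - y i) := by
            rw [hitParam, signOf_decide, if_neg (not_lt.2 hneg.le), if_pos hneg, abs_of_neg hneg,
              show -(y i - s i) = s i - y i by ring]
            push_cast; ring
          rwa [hμ] at this
  · intro j' hj1' hj'
    rcases Nat.lt_or_ge j' j with hlt | hge
    · exact (hI.lv j' hj1' hlt).congr (hPA.mono (by omega))
    · have : j' = j := by omega
      subst this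
      exact levelOK_of_apexPred hI hj1 hA hchart' hx' hp' hρ' hs' (prev_records hI hPA).1 (prev_records hI hPA).2
  · intro _
    rw [recAt_cons_of_lt dat _ dat' hlev (by rw [hI.len]; exact hj1)]
    exact hI.rec0 hj1

/-- **The level step** (`1 ≤ j ≤ D`): from the invariant at level `j`, running the tasks of level `j`
either reaches the bottom (final invariant at `J = j`) or establishes the invariant at level `j+1`.
[cite: FournierKoiran2000, §2.1 Step k] -/
theorem level_step {dat : Data Q.D} {j : ℕ} (hI : Inv xh dat j) (hj1 : 1 ≤ j) :
    ((runFrom Q finT xh dat (levelTasks Q j)).done = false ∧ Inv xh (runFrom Q finT xh dat (levelTasks Q j)) (j + 1)) ∨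
    ((runFrom Q finT xh dat (levelTasks Q j)).done = true ∧ FinalInv xh (runFrom Q finT xh dat (levelTasks Q j)) j) := by
  classical
  set Γ := certOf Q dat with hΓ
  set y := Γ.xProj xh j with hy
  set Λ := ctxStar dat j xh with hΛ
  have hdone := hI.done
  have hW : Λ.WF := ctxStar_wf hI hj1
  have hsd : Λ.SoundChoose Λ.chooseForm := Λ.soundChoose_chooseForm
  -- decompose the tasks
  have htasks : levelTasks Q j =
      ((((List.finRange Q.D).flatMap fun i => (List.range (Q.L + 1)).map (Task.bs i)) ++
       ((List.range (Q.D + 1)).flatMap fun sc =>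
          ((List.range (Q.D + 1)).flatMap fun m => Task.ex sc m :: (List.range Q.Wf).map (Task.pf sc m)) ++ [Task.st sc])) ++
       (List.range Q.Wa).map Task.ap) ++
      ((((List.finRange Q.D).flatMap fun i => [Task.eqGe i, Task.eqLe i]) ++ (List.finRange Q.D).map Task.fa) ++ [Task.close]) := by
    simp only [levelTasks, if_neg (show j ≠ 0 by omega), List.append_assoc]
  -- binary search
  set base₁ : Scratch Q.D := { Scratch.init Q.D with m := mStar dat j xh, bsAcc := 0 } with hbase₁
  have hBS : runFrom Q finT xh dat ((List.finRange Q.D).flatMap fun i => (List.range (Q.L + 1)).map (Task.bs i)) =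
      dat.withCur base₁ := by
    rw [run_bs dat hdone (by rw [hI.cur]; rfl) y (fun c i k hk hi => by
      rw [truth_sign_eq hI c _ rfl]
      simp only [localForm, Data.withCur_cur]
      rw [← hy]
      by_cases h : (-1 : ℝ) + (2 * ((if k = 0 then 0 else c.bsAcc : ℕ) : ℝ) + 1) / 2 ^ k ≤ y i
      · rw [decide_eq_true h, decide_eq_true ((aff_bsForm_nonneg_iff i k _ y).2 h)]
      · rw [decide_eq_false h, decide_eq_false (fun h' => h ((aff_bsForm_nonneg_iff i k _ y).1 h'))])
      (List.finRange Q.D)]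
    rw [hI.cur]
    congr 1
    rw [hbase₁]
    refine Scratch.ext (funext fun i => ?_) rfl rfl rfl rfl rfl rfl rfl rfl rfl
    simp [List.mem_finRange, mStar, hy, hΓ]
  -- the searches
  have hΛeq : (⟨dat.chart, dat.levels.map fun r => r.apex.1, base₁.m⟩ : LevelCtx Q) = Λ := rfl
  set scS := Λ.scStar Λ.chooseForm with hscS
  set chS := Λ.chainOf Λ.chooseForm scS with hchS
  have hsc : scS ≤ Q.D := (Λ.scStar_spec hsd hW).1
  have hSC : runFrom Q finT xh (dat.withCur base₁)
      ((List.range (Q.D + 1)).flatMap fun sc =>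
        ((List.range (Q.D + 1)).flatMap fun m => Task.ex sc m :: (List.range Q.Wf).map (Task.pf sc m)) ++ [Task.st sc]) =
      dat.withCur (scSt base₁ (some (scS, chS)) [] false []) := by
    have h := run_scales (finT := finT) (xh := xh) dat hdone base₁ (Q.D + 1)
    rw [hΛeq, stableAfter_eq Λ hsd hW, if_pos (show scS < Q.D + 1 by omega)] at h
    exact h
  -- the apex
  set apexS := Λ.chooseApex scS chS with hapexS
  have hAP : runFrom Q finT xh (dat.withCur (scSt base₁ (some (scS, chS)) [] false [])) ((List.range Q.Wa).map Task.ap) =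
      dat.withCur { scSt base₁ (some (scS, chS)) [] false [] with apex := apexS, bits := [] } :=
    run_ap (finT := finT) (xh := xh) dat hdone (scSt base₁ (some (scS, chS)) [] false []) rfl (scS, chS) rfl
  have hApred : Λ.ApexPredCh scS chS apexS.1 apexS.2 :=
    Λ.apexPredCh_chooseApex (Λ.exists_apexPred hsd hW)
  have hApred' : Λ.ApexPred Λ.chooseForm scS apexS.1 apexS.2 := (Λ.apexPred_iff _ _ _ _).2 hApred
  have hd : 0 < apexS.2 := hApred.1
  -- closing the level
  set base₂ : Scratch Q.D := { scSt base₁ (some (scS, chS)) [] false [] with apex := apexS, bits := [] } with hbase₂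
  have hrun : runFrom Q finT xh dat (levelTasks Q j) = finishLevel Q (dat.withCur (closeScratch dat j xh base₂)) := by
    rw [htasks, runFrom_append Q finT xh dat, runFrom_append Q finT xh dat, runFrom_append Q finT xh dat, hBS, hSC, hAP]
    exact run_close_level hI base₂ hd rfl
  rw [hrun]
  -- the closing scratch and the facet fold
  set s : Fin Q.D → ℝ := fun k => (apexS.1 k : ℝ) / apexS.2 with hs
  set cs := closeScratch dat j xh base₂ with hcs
  have hcs_apex : cs.apex = apexS := rfl
  have hcs_stable : cs.stable = some (scS, chS) := rfl
  have hcs_ge : cs.ge = fun i => decide (0 ≤ y i - s i) := rfl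
  have hcs_le : cs.le = fun i => decide (0 ≤ -(y i - s i)) := rfl
  set valid : Fin Q.D → Bool := (dat.withCur { base₂ with ge := cs.ge, le := cs.le }).validB with hvalid
  set bb : Fin Q.D → Fin Q.D → Bool := fun c i =>
    decide (0 ≤ aff (faForm apexS (signOf (cs.ge c) (cs.le c)) (signOf (cs.ge i) (cs.le i)) c i) y) with hbb
  have hcs_cand : cs.cand = (List.finRange Q.D).foldl (faFold valid bb) none := rfl
  have hvalid_iff : ∀ i, valid i = true ↔ dat.chart i = 0 ∧ y i - s i ≠ 0 := by
    intro i
    rw [hvalid, validB_withCur]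
    simp only [hcs_ge, hcs_le, Bool.and_eq_true, decide_eq_true_eq]
    rw [signOf_decide_ne_zero_iff]
  have hspec := faFold_spec valid bb (hitParam y s) (fun c i hc hi hci => by
    rw [hvalid_iff] at hc hi
    rw [hbb]
    simp only [decide_eq_true_eq, hcs_ge, hcs_le]
    exact faForm_nonneg_iff apexS hd y hci hc.2 hi.2) (List.finRange Q.D) (List.nodup_finRange Q.D)
  have hsc' : (cs.stable.map Prod.fst).getD 0 = scS := by rw [hcs_stable]; rfl
  have hrec : ∀ (i0 : Fin Q.D) (e0 : ℤ), closeRec Q cs i0 e0 = ⟨mStar dat j xh, scS, (apexS.1, apexS.2), i0, e0⟩ := by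
    intro i0 e0; simp only [closeRec, hsc']; rfl
  rcases hspec with ⟨hnone, hall⟩ | ⟨c, hsome, hvc, -, hmin⟩
  · -- BOTTOM
    right
    have hfl := finishLevel_none (dat.withCur cs) (by rw [Data.withCur_cur, hcs_cand, hnone])
    simp only [Data.withCur_cur, Data.withCur_out, Data.withCur_chart, Data.withCur_levels, hrec] at hfl
    have hdone' : (finishLevel Q (dat.withCur cs)).done = true := by rw [hfl]
    refine ⟨hdone', finalInv_of_bottom hI hj1 hApred' _ hdone' ⟨0, Q.D_pos⟩ 1 (by rw [hfl]) (fun i hi => ?_)⟩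
    have hv : valid i = false := hall i (List.mem_finRange i)
    have : ¬ (dat.chart i = 0 ∧ y i - s i ≠ 0) := by rw [← hvalid_iff, hv]; simp
    push Not at this
    have := this hi
    rw [hy, hs] at this
    linarith
  · -- CONTINUE
    left
    have hvc' := (hvalid_iff c).1 hvc
    have hgc : cs.ge c = decide (0 ≤ y c - s c) := congrFun hcs_ge c
    have hfl := finishLevel_some (dat.withCur cs) c (by rw [Data.withCur_cur, hcs_cand, hsome])
    have hmin' : ∀ i, dat.chart i = 0 → y i - s i ≠ 0 → hitParam y s c ≤ hitParam y s i :=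
      fun i hi hne => hmin i (List.mem_finRange i) ((hvalid_iff i).2 ⟨hi, hne⟩)
    rcases lt_or_gt_of_ne hvc'.2 with hlt | hgt
    · have hgcv : cs.ge c = false := by rw [hgc, decide_eq_false (not_le.2 hlt)]
      simp only [Data.withCur_cur, Data.withCur_out, Data.withCur_chart, Data.withCur_levels, Data.withCur_done,
        hdone, hgcv, hrec, Bool.false_eq_true, if_false] at hfl
      have hdone' : (finishLevel Q (dat.withCur cs)).done = false := by rw [hfl]
      refine ⟨hdone', inv_of_continue hI hj1 hApred' hd _ hdone' (by rw [hfl]) c (-1) (by rw [hfl]) (by rw [hfl])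
        hvc'.1 (Or.inr ⟨hlt, rfl⟩) hmin'⟩
    · have hgcv : cs.ge c = true := by rw [hgc, decide_eq_true hgt.le]
      simp only [Data.withCur_cur, Data.withCur_out, Data.withCur_chart, Data.withCur_levels, Data.withCur_done,
        hdone, hgcv, hrec, if_true] at hfl
      have hdone' : (finishLevel Q (dat.withCur cs)).done = false := by rw [hfl]
      refine ⟨hdone', inv_of_continue hI hj1 hApred' hd _ hdone' (by rw [hfl]) c 1 (by rw [hfl]) (by rw [hfl])
        hvc'.1 (Or.inl ⟨hgt, rfl⟩) hmin'⟩

end Step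

/-! ### Level `0`, termination, and the main theorem -/

section Main

variable {Q}

/-- The initial state satisfies the invariant at level `0`. [folklore] -/
theorem inv_init : Inv xh (Data.init Q.D) 0 := by
  refine ⟨rfl, rfl, rfl, fun r hr => by simp [Data.init] at hr, rfl, ⟨?_, ?_, ?_, ?_, ?_⟩, ?_, ?_⟩
  · funext i
    simp [certOf, Data.recAt, Data.levelsOld, Data.init, LevelRec.dflt]
  · intro j _ hj; omega
  · intro j hj; omega
  · intro j hj; omega
  · intro j hj; omega
  · intro j' _ hj'; omega
  · intro h; omega

/-- **Level `0`** (homogenisation, apex `0`): from the initial state, the tasks of level `0` establish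
the invariant at level `1`, provided `x̂ ≠ 0`. [cite: FournierKoiran2000, §2.3 ("this algorithm first determines a face `f` of the cube such that `x̃ ∈ P(0,f)`")] -/
theorem level_zero (hx : ∃ i, xh i ≠ 0) :
    (runFrom Q finT xh (Data.init Q.D) (levelTasks Q 0)).done = false ∧
      Inv xh (runFrom Q finT xh (Data.init Q.D) (levelTasks Q 0)) 1 := by
  classical
  have hI : Inv xh (Data.init Q.D) 0 := inv_init
  have htasks : levelTasks Q 0 =
      (((List.finRange Q.D).flatMap fun i => [Task.eqGe i, Task.eqLe i]) ++ (List.finRange Q.D).map Task.fa) ++ [Task.close] := by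
    simp only [levelTasks, if_true, List.nil_append]
  have hrun : runFrom Q finT xh (Data.init Q.D) (levelTasks Q 0) =
      finishLevel Q ((Data.init Q.D).withCur (closeScratch (Data.init Q.D) 0 xh (Scratch.init Q.D))) := by
    rw [htasks]
    exact run_close_level hI (Scratch.init Q.D) Nat.one_pos rfl
  rw [hrun]
  set cs := closeScratch (Data.init Q.D) 0 xh (Scratch.init Q.D) with hcs
  -- here `y = x̂` and `s = 0`
  have hy : (certOf Q (Data.init Q.D)).xProj xh 0 = xh := rfl
  set s : Fin Q.D → ℝ := fun k => (((Scratch.init Q.D).apex.1 k : ℤ) : ℝ) / (Scratch.init Q.D).apex.2 with hs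
  have hs0 : s = 0 := by funext k; simp [hs, Scratch.init]
  have hcs_ge : cs.ge = fun i => decide (0 ≤ xh i - s i) := rfl
  have hcs_le : cs.le = fun i => decide (0 ≤ -(xh i - s i)) := rfl
  set valid : Fin Q.D → Bool := ((Data.init Q.D).withCur { Scratch.init Q.D with ge := cs.ge, le := cs.le }).validB
    with hvalid
  set bb : Fin Q.D → Fin Q.D → Bool := fun c i =>
    decide (0 ≤ aff (faForm (Scratch.init Q.D).apex (signOf (cs.ge c) (cs.le c)) (signOf (cs.ge i) (cs.le i)) c i) xh)
    with hbb
  have hcs_cand : cs.cand = (List.finRange Q.D).foldl (faFold valid bb) none := rfl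
  have hvalid_iff : ∀ i, valid i = true ↔ xh i - s i ≠ 0 := by
    intro i
    rw [hvalid, validB_withCur]
    simp only [hcs_ge, hcs_le, Bool.and_eq_true, decide_eq_true_eq]
    rw [signOf_decide_ne_zero_iff]
    simp [Data.init]
  have hd1 : 0 < (Scratch.init Q.D).apex.2 := Nat.one_pos
  have hspec := faFold_spec valid bb (hitParam xh s) (fun c i hc hi hci => by
    rw [hvalid_iff] at hc hi
    rw [hbb]
    simp only [decide_eq_true_eq, hcs_ge, hcs_le]
    exact faForm_nonneg_iff (Scratch.init Q.D).apex hd1 xh hci hc hi) (List.finRange Q.D) (List.nodup_finRange Q.D)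
  have hrec : ∀ (i0 : Fin Q.D) (e0 : ℤ), closeRec Q cs i0 e0 = ⟨0, 0, (0, 1), i0, e0⟩ := by
    intro i0 e0; rfl
  rcases hspec with ⟨hnone, hall⟩ | ⟨c, hsome, hvc, -, hmin⟩
  · exfalso
    obtain ⟨i, hi⟩ := hx
    have hv := hall i (List.mem_finRange i)
    have : ¬ (xh i - s i ≠ 0) := by rw [← hvalid_iff, hv]; simp
    rw [hs0] at this
    exact this (by simpa using hi)
  · have hvc' := (hvalid_iff c).1 hvc
    have hgc : cs.ge c = decide (0 ≤ xh c - s c) := congrFun hcs_ge c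
    have hfl := finishLevel_some ((Data.init Q.D).withCur cs) c (by rw [Data.withCur_cur, hcs_cand, hsome])
    have hmin' : ∀ i, xh i - s i ≠ 0 → hitParam xh s c ≤ hitParam xh s i :=
      fun i hne => hmin i (List.mem_finRange i) ((hvalid_iff i).2 hne)
    -- the common part, for `ε = ±1` matching the sign
    have key : ∀ (ε : ℤ) (dat' : Data Q.D), dat'.done = false → dat'.cur = Scratch.init Q.D →
        dat'.levels = [⟨0, 0, (0, 1), c, ε⟩] → dat'.chart = Function.update (0 : Fin Q.D → ℤ) c ε →
        ((0 < xh c - s c ∧ ε = 1) ∨ (xh c - s c < 0 ∧ ε = -1)) → Inv xh dat' 1 := by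
      intro ε dat' hdone' hcur' hlev hchartd hsign
      have hnew := certOf_at_new (Data.init Q.D) ⟨0, 0, (0, 1), c, ε⟩ dat' hlev
      simp only [Data.init, List.length_nil] at hnew
      obtain ⟨hp', hρ', hs', hi', hε'⟩ := hnew
      have hsR' : (certOf Q dat').sR 0 = s := by funext i; simp [Cert.sR, hs', hs0]
      have hx' : (certOf Q dat').xProj xh 0 = xh := rfl
      have hexitParam : (certOf Q dat').exitParam xh 0 = hitParam xh s c := by
        rw [Cert.exitParam, hx', hsR', hi', hε', hitParam, signOf_decide]
        rcases hsign with ⟨h, he⟩ | ⟨h, he⟩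
        · rw [he, if_pos h]
        · rw [he, if_neg (not_lt.2 h.le), if_pos h]
      refine ⟨hdone', hcur', by rw [hlev]; rfl, ?_, ?_, ⟨?_, ?_, ?_, ?_, ?_⟩, ?_, ?_⟩
      · intro r hr; rw [hlev, List.mem_singleton] at hr; subst hr; exact Nat.one_pos
      · rw [hchartd]; funext i
        rw [Cert.chart_succ_apply, hi', hε', Cert.chart_zero, Function.update_apply]; rfl
      · funext i; simp [hs']
      · intro j hj1 hj; omega
      · intro j hj; have : j = 0 := by omega
        subst this; rw [hi']; rfl
      · intro j hj; have : j = 0 := by omega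
        subst this; rw [hx', hsR', hi', hε']; exact hsign
      · intro j hj i _
        have : j = 0 := by omega
        subst this
        rw [hexitParam, hx', hsR']
        constructor
        · intro hpos
          have := hmin' i hpos.ne'
          have hμ : hitParam xh s i = (1 - s i) / (xh i - s i) := by
            rw [hitParam, signOf_decide, if_pos hpos, abs_of_pos hpos]; push_cast; ring
          rwa [hμ] at this
        · intro hneg
          have := hmin' i hneg.ne
          have hμ : hitParam xh s i = (1 + s i) / (s i - xh i) := by
            rw [hitParam, signOf_decide, if_neg (not_lt.2 hneg.le), if_pos hneg, abs_of_neg hneg,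
              show -(xh i - s i) = s i - xh i by ring]
            push_cast; ring
          rwa [hμ] at this
      · intro j' hj1' hj'; omega
      · intro _
        simp [Data.recAt, Data.levelsOld, hlev]
    rcases lt_or_gt_of_ne hvc' with hlt | hgt
    · have hgcv : cs.ge c = false := by rw [hgc, decide_eq_false (not_le.2 hlt)]
      simp only [Data.withCur_cur, Data.withCur_out, Data.withCur_chart, Data.withCur_levels, Data.withCur_done,
        hgcv, hrec, Bool.false_eq_true, if_false] at hfl
      have hdone' : (finishLevel Q ((Data.init Q.D).withCur cs)).done = false := by rw [hfl]; rfl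
      exact ⟨hdone', key (-1) _ hdone' (by rw [hfl]) (by rw [hfl]; rfl) (by rw [hfl]; rfl) (Or.inr ⟨hlt, rfl⟩)⟩
    · have hgcv : cs.ge c = true := by rw [hgc, decide_eq_true hgt.le]
      simp only [Data.withCur_cur, Data.withCur_out, Data.withCur_chart, Data.withCur_levels, Data.withCur_done,
        hgcv, hrec, if_true] at hfl
      have hdone' : (finishLevel Q ((Data.init Q.D).withCur cs)).done = false := by rw [hfl]; rfl
      exact ⟨hdone', key 1 _ hdone' (by rw [hfl]) (by rw [hfl]; rfl) (by rw [hfl]; rfl) (Or.inl ⟨hgt, rfl⟩)⟩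

/-- Under partial validity, chart `j'` fixes exactly `j'` coordinates. [cite: FournierKoiran2000, §2.1 (one more coordinate is fixed at each step)] -/
theorem card_fixed {Γ : Cert Q.D} {J' : ℕ} (hV : Γ.ValidBelow xh J') :
    ∀ j, j ≤ J' → (Finset.univ.filter fun i => Γ.chart j i ≠ 0).card = j := by
  classical
  intro j
  induction j with
  | zero => intro _; simp
  | succ j ih =>
    intro hj
    have hfree := hV.exit_free j (by omega)
    have hne : Γ.εstar j ≠ 0 := by
      rcases hV.exit_sign j (by omega) with ⟨-, h⟩ | ⟨-, h⟩ <;> simp [h]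
    have hset : (Finset.univ.filter fun i => Γ.chart (j + 1) i ≠ 0) =
        insert (Γ.istar j) (Finset.univ.filter fun i => Γ.chart j i ≠ 0) := by
      ext i
      simp only [Finset.mem_filter, Finset.mem_univ, true_and, Finset.mem_insert, Cert.chart_succ_apply]
      by_cases h : i = Γ.istar j
      · subst h; simp [hne]
      · simp [h]
    rw [hset, Finset.card_insert_of_notMem (by simp [hfree]), ih (by omega)]

/-- The invariant bounds the level by the dimension. [folklore] -/
theorem Inv.le_D {dat : Data Q.D} {j : ℕ} (hI : Inv xh dat j) : j ≤ Q.D := by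
  classical
  have h := card_fixed hI.vb j le_rfl
  have : (Finset.univ.filter fun i => (certOf Q dat).chart j i ≠ 0).card ≤ Q.D := by
    calc (Finset.univ.filter fun i => (certOf Q dat).chart j i ≠ 0).card ≤ (Finset.univ : Finset (Fin Q.D)).card :=
          Finset.card_filter_le _ _
      _ = Q.D := by simp
  omega

/-- Done states are idle. [folklore] -/
theorem runFrom_of_done (dat : Data Q.D) (hdone : dat.done = true) : ∀ ts : List (Task Q.D), runFrom Q finT xh dat ts = dat := by
  intro ts
  induction ts with
  | nil => rfl
  | cons τ ts ih =>
    rw [runFrom_cons, step]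
    have : upd Q dat τ (truth finT (certOf Q) xh dat τ) = dat := by simp [upd, hdone]
    rw [this, ih]

/-- **The run of levels `0, …, n`.** For `n ≤ D+1`: either the invariant holds at level `n` (not done),
or the bottom was reached at some `J < n`. [cite: FournierKoiran2000, §2.1] -/
theorem run_levels (hx : ∃ i, xh i ≠ 0) :
    ∀ n, n ≤ Q.D + 1 →
      ((runFrom Q finT xh (Data.init Q.D) ((List.range n).flatMap (levelTasks Q))).done = false ∧
        Inv xh (runFrom Q finT xh (Data.init Q.D) ((List.range n).flatMap (levelTasks Q))) n) ∨
      ((runFrom Q finT xh (Data.init Q.D) ((List.range n).flatMap (levelTasks Q))).done = true ∧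
        ∃ J < n, FinalInv xh (runFrom Q finT xh (Data.init Q.D) ((List.range n).flatMap (levelTasks Q))) J) := by
  intro n
  induction n with
  | zero => intro _; left; exact ⟨rfl, inv_init⟩
  | succ n ih =>
    intro hn
    rw [show List.range (n + 1) = List.range n ++ [n] from List.range_succ, List.flatMap_append, runFrom_append,
      List.flatMap_singleton]
    rcases ih (by omega) with ⟨hnd, hI⟩ | ⟨hd, J, hJ, hF⟩
    · rcases Nat.eq_zero_or_pos n with rfl | hpos
      · left
        simp only [List.range_zero, List.flatMap_nil, runFrom_nil]
        exact level_zero hx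
      · rcases level_step (finT := finT) hI hpos with ⟨h1, h2⟩ | ⟨h1, h2⟩
        · exact Or.inl ⟨h1, h2⟩
        · exact Or.inr ⟨h1, n, Nat.lt_succ_self n, h2⟩
    · right
      rw [runFrom_of_done _ hd]
      exact ⟨hd, J, by omega, hF⟩

/-- **The location protocol produces a valid certificate** for every input `x̂ ≠ 0`.
[cite: FournierKoiran2000, Thm 2 (the location problem is solved in `FP⁰_ℝovs(NP)`)] -/
theorem finalData_valid (hx : ∃ i, xh i ≠ 0) : (certOf Q (finalData Q finT xh)).Valid xh Q.B Q.r := by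
  rcases run_levels (finT := finT) hx (Q.D + 1) le_rfl with ⟨-, hI⟩ | ⟨-, J, -, hF⟩
  · exact absurd hI.le_D (by omega)
  · exact hF.valid

/-- The final state is done (so the machine may ask the final query). [folklore] -/
theorem finalData_done (hx : ∃ i, xh i ≠ 0) : (finalData Q finT xh).done = true := by
  rcases run_levels (finT := finT) hx (Q.D + 1) le_rfl with ⟨-, hI⟩ | ⟨hd, -⟩
  · exact absurd hI.le_D (by omega)
  · exact hd

/-- The final state has at least one level record and all apex denominators positive. [folklore] -/
theorem finalData_levels (hx : ∃ i, xh i ≠ 0) :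
    (finalData Q finT xh).levels ≠ [] ∧ ∀ r ∈ (finalData Q finT xh).levels, 0 < r.apex.2 := by
  rcases run_levels (finT := finT) hx (Q.D + 1) le_rfl with ⟨-, hI⟩ | ⟨-, J, -, hF⟩
  · exact absurd hI.le_D (by omega)
  · have hlen : (finalData Q finT xh).levels.length = J + 1 := hF.len
    have hpos : ∀ r ∈ (finalData Q finT xh).levels, 0 < r.apex.2 := hF.apex_pos
    exact ⟨fun h => by rw [h] at hlen; simp at hlen, hpos⟩

end Main

end FKPointLocation

end Literature.Computability.Complexity
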